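import Literature.Topology.FourManifolds.TrisectionsMidSectorBand
import Literature.Topology.FourManifolds.FlowFibreMorseIndex
import Literature.Topology.FourManifolds.TrisectionsSectorsOneThree
import Literature.Topology.FourManifolds.TrisectionsSectorTwoFlowRule
import Literature.Topology.FourManifolds.HCobordismTradeStep
import HarnessLib

/-!
# A boundary-adapted function on the middle sector `X₂` (Gay–Kirby 2016, Lemma 14), IV:
# the flow-rule region — critical points over the critical points of the Heegaard function

Topic `Literature/Topology/FourManifolds`; infrastructure for the fact seat
`provefact-Literature.Topology.FourManifolds.exists_isBalancedGKTrisection` (Gay–Kirby 2016,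
Thm. 4 via §4, Lemma 14).  Everything in this file is **proved**; no named facts are introduced.

Above the unit band and off the handle columns, the function `Ψ₂ = (-V)(-M̃) W R` of
`TrisectionsMidSectorFunction.lean` is a function of the lifted Heegaard function
`φ̄ = g ∘ λ` and of `f` alone (`MidParams.PsiTwo_eventuallyEq_Γ₂`):

  `Ψ₂ = Γ₂(φ̄, f)`,  `Γ₂(p, q) = (q - a) · m(p, q) · w(p)`,  `m(p, q) = -(p - b) - σ_ε(q - c - (p - b))`

(`-V = s = f - a` above the bevel, `-M̃ = -M = m(φ̄, f)`, `W = w(φ̄)` off the zones, `R = 1` off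
the columns).  This file computes the partials of `Γ₂` (`∂₂Γ₂ = w[m - (q - a)σ']`,
`∂₁Γ₂ = (q - a)[(σ' - 1)w + m w']`, `∂₂₂Γ₂ = -w[2σ' + (q - a)σ'']`, with `σ' = σ_ε'`, `σ'' ≥ 0`) and
feeds the flow-rule theorems of `FlowFibreMorseData/Index.lean` (Milnor's fibre rule): at an
interior point of `X₂` in the **flow-rule region**
`FR = {Hit, s > rOut₁, A_j > a_R on the chart domains}`,

* `MidParams.isMCriticalPt_psiTwo_iff_of_mem_FR` — **`ψ₂` is critical iff `∂₂Γ₂(φ̄, f) = 0` and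
  the landing point `λ` is a critical point of `g`** (where `∂₂Γ₂ = 0` one has `m = (q - a)σ' > 0`,
  so `σ' > 0`, and `∂₁Γ₂ < 0`: either `σ' < 1`, or the rounding is on its plateau, the point is at
  mid-height and `w' < 0` there, `MidParams.fderiv_Γ₂_fst_neg`);
* `MidParams.morseData_psiTwo_of_mem_FR` — **such a critical point is nondegenerate, of index
  the Morse index of `g` at the landing point** (`∂₂₂Γ₂ < 0`, `∂₁Γ₂ < 0` and `ψ₂ = 1 - C Ψ₂`:
  index `0 + index_g` by `morseIndex_comp₂_flow_eq`).

## References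

* D. Gay, R. Kirby, *Trisecting 4-manifolds*, Geom. Topol. 20 (2016), §4, Lemma 14. [GayKirby2016]
* J. Milnor, *Morse theory* (1963), §2–§3. [Milnor1963]
* J. Milnor, *Lectures on the h-cobordism theorem* (1965), Thm. 3.4, Thm. 4.1. [MilnorHCobordism1965]
-/

open scoped Manifold ContDiff Topology
open Set Function Filter

noncomputable section

universe u

namespace Literature.Topology.FourManifolds

open Flow

variable {X : Type u} [TopologicalSpace X] [T2Space X] [CompactSpace X]
  [ChartedSpace (EuclideanSpace ℝ (Fin 4)) X] [IsManifold (𝓡 4) ∞ X]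

namespace BiCollar

namespace TriData

namespace TubeFrame

namespace MidParams

variable {B : BiCollar X} {T : B.TriData} {ι : Type} [Fintype ι] {𝔉 : T.TubeFrame ι} (𝔔 : 𝔉.MidParams)

/-! ### The profile `Γ₂` and its partial derivatives -/

/-- The crease coordinate of the profile: `w_c(p, q) = q - c - (p - b)`. [folklore] -/
def _root_.Literature.Topology.FourManifolds.BiCollar.TriData.wcr (T : B.TriData) (q : ℝ × ℝ) : ℝ :=
  q.2 - T.c - (q.1 - B.b)

/-- The rounded height factor of the profile: `m(p, q) = -(p - b) - σ_ε(w_c)` (`= -M` at a hitting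
point with `φ̄ = p`, `f = q`). [cite: GayKirby2016, §4, Lemma 14] -/
def _root_.Literature.Topology.FourManifolds.BiCollar.TriData.mcr (T : B.TriData) (q : ℝ × ℝ) : ℝ :=
  -(q.1 - B.b) - creaseσ T.ε (T.wcr q)

/-- `σ' = σ_ε'(w_c) ∈ [0, 1]`. [folklore] -/
def _root_.Literature.Topology.FourManifolds.BiCollar.TriData.σcr (T : B.TriData) (q : ℝ × ℝ) : ℝ :=
  creaseStep (T.wcr q / T.ε)

/-- **The profile of `Ψ₂` in the flow-rule region**: `Γ₂(p, q) = (q - a) m(p, q) w(p)`. [cite: GayKirby2016, §4, Lemma 14] -/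
def Γ₂ (𝔔 : 𝔉.MidParams) (q : ℝ × ℝ) : ℝ := (q.2 - B.a) * T.mcr q * 𝔔.w q.1

/-- **The profile of `ψ₂`**: `Γ̂₂ = 1 - C Γ₂`. [cite: GayKirby2016, §4, Lemma 14] -/
def Γh (𝔔 : 𝔉.MidParams) (q : ℝ × ℝ) : ℝ := 1 - 𝔔.C * 𝔔.Γ₂ q

omit [T2Space X] [CompactSpace X] in
/-- Unfolding of `Γ₂`. [folklore] -/
theorem Γ₂_apply (q : ℝ × ℝ) :
    𝔔.Γ₂ q = (q.2 - B.a) * (-(q.1 - B.b) - creaseσ T.ε (q.2 - T.c - (q.1 - B.b))) * 𝔔.w q.1 := rfl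

omit [T2Space X] [CompactSpace X] in
/-- `Γ₂` is smooth. [folklore] -/
theorem contDiff_Γ₂ : ContDiff ℝ ∞ 𝔔.Γ₂ := by
  have h1 : ContDiff ℝ ∞ fun q : ℝ × ℝ => q.2 - B.a := by fun_prop
  have h2 : ContDiff ℝ ∞ fun q : ℝ × ℝ => q.2 - T.c - (q.1 - B.b) := by fun_prop
  have h3 : ContDiff ℝ ∞ fun q : ℝ × ℝ => -(q.1 - B.b) - creaseσ T.ε (q.2 - T.c - (q.1 - B.b)) :=
    (by fun_prop : ContDiff ℝ ∞ fun q : ℝ × ℝ => -(q.1 - B.b)).sub ((contDiff_creaseσ T.ε).comp h2)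
  exact (h1.mul h3).mul (𝔔.w_contDiff.comp contDiff_fst)

omit [T2Space X] [CompactSpace X] in
/-- `Γ̂₂` is smooth. [folklore] -/
theorem contDiff_Γh : ContDiff ℝ ∞ 𝔔.Γh := contDiff_const.sub (contDiff_const.mul 𝔔.contDiff_Γ₂)

omit [T2Space X] [CompactSpace X] in
/-- **The first partials of `Γ₂`**: `∂₂Γ₂ = w [m - (q - a)σ']`,
`∂₁Γ₂ = (q - a)[(σ' - 1) w + m w']`. [folklore] -/
theorem Γ₂_partials (q : ℝ × ℝ) :
    fderiv ℝ 𝔔.Γ₂ q (0, 1) = 𝔔.w q.1 * (T.mcr q - (q.2 - B.a) * T.σcr q) ∧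
      fderiv ℝ 𝔔.Γ₂ q (1, 0) = (q.2 - B.a) * ((T.σcr q - 1) * 𝔔.w q.1 + T.mcr q * deriv 𝔔.w q.1) := by
  have hd : Differentiable ℝ 𝔔.Γ₂ := 𝔔.contDiff_Γ₂.differentiable (by simp)
  have hwd := 𝔔.w_contDiff.differentiable (by simp)
  have hε := T.ε_pos
  constructor
  · rw [fderiv_apply_eq_deriv_line (hd q)]
    have hfun : (fun t : ℝ => 𝔔.Γ₂ (q + t • ((0 : ℝ), (1 : ℝ)))) =
        fun t => ((q.2 - B.a) + t) * (-(q.1 - B.b) - creaseσ T.ε (T.wcr q + t)) * 𝔔.w q.1 := by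
      funext t
      simp only [Γ₂, TriData.mcr, TriData.wcr, Prod.smul_mk, smul_eq_mul, mul_zero, mul_one, Prod.fst_add,
        Prod.snd_add, add_zero]
      ring_nf
    rw [hfun]
    have ht : HasDerivAt (fun t : ℝ => (q.2 - B.a) + t) 1 0 := by simpa using (hasDerivAt_id (0 : ℝ)).const_add (q.2 - B.a)
    have hσ : HasDerivAt (fun t : ℝ => creaseσ T.ε (T.wcr q + t)) (creaseStep ((T.wcr q + 0) / T.ε)) 0 :=
      HasDerivAt.comp_const_add (T.wcr q) 0 (hasDerivAt_creaseσ hε _)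
    have hm : HasDerivAt (fun t : ℝ => -(q.1 - B.b) - creaseσ T.ε (T.wcr q + t)) (0 - creaseStep ((T.wcr q + 0) / T.ε)) 0 :=
      (hasDerivAt_const _ _).sub hσ
    have h1 : HasDerivAt (fun t : ℝ => ((q.2 - B.a) + t) * (-(q.1 - B.b) - creaseσ T.ε (T.wcr q + t)) * 𝔔.w q.1)
        ((1 * (-(q.1 - B.b) - creaseσ T.ε (T.wcr q + 0)) + ((q.2 - B.a) + 0) * (0 - creaseStep ((T.wcr q + 0) / T.ε))) *
          𝔔.w q.1) 0 := (ht.mul hm).mul_const _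
    rw [h1.deriv]
    simp only [add_zero, TriData.mcr, TriData.σcr]
    ring
  · rw [fderiv_apply_eq_deriv_line (hd q)]
    have hfun : (fun t : ℝ => 𝔔.Γ₂ (q + t • ((1 : ℝ), (0 : ℝ)))) =
        fun t => (q.2 - B.a) * (((B.b - q.1) - t) - creaseσ T.ε (T.wcr q - t)) * 𝔔.w (q.1 + t) := by
      funext t
      simp only [Γ₂, TriData.mcr, TriData.wcr, Prod.smul_mk, smul_eq_mul, mul_zero, mul_one, Prod.fst_add,
        Prod.snd_add, add_zero]
      ring_nf
    rw [hfun]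
    have ht : HasDerivAt (fun t : ℝ => (B.b - q.1) - t) (-1) 0 := by
      simpa using (hasDerivAt_id (0 : ℝ)).const_sub (B.b - q.1)
    have hin : HasDerivAt (fun t : ℝ => T.wcr q - t) (-1) 0 := by
      simpa using (hasDerivAt_id (0 : ℝ)).const_sub (T.wcr q)
    have hσ : HasDerivAt (fun t : ℝ => creaseσ T.ε (T.wcr q - t)) (creaseStep ((T.wcr q - 0) / T.ε) * (-1)) 0 :=
      (hasDerivAt_creaseσ hε _).comp 0 hin
    have hm : HasDerivAt (fun t : ℝ => ((B.b - q.1) - t) - creaseσ T.ε (T.wcr q - t))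
        (-1 - creaseStep ((T.wcr q - 0) / T.ε) * (-1)) 0 := ht.sub hσ
    have hww : HasDerivAt (fun t : ℝ => 𝔔.w (q.1 + t)) (deriv 𝔔.w (q.1 + 0)) 0 :=
      HasDerivAt.comp_const_add q.1 0 (hwd (q.1 + 0)).hasDerivAt
    have h1 : HasDerivAt (fun t : ℝ => (q.2 - B.a) * (((B.b - q.1) - t) - creaseσ T.ε (T.wcr q - t)) * 𝔔.w (q.1 + t))
        ((q.2 - B.a) * (-1 - creaseStep ((T.wcr q - 0) / T.ε) * (-1)) * 𝔔.w (q.1 + 0) +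
          (q.2 - B.a) * (((B.b - q.1) - 0) - creaseσ T.ε (T.wcr q - 0)) * deriv 𝔔.w (q.1 + 0)) 0 :=
      (hm.const_mul (q.2 - B.a)).mul hww
    rw [h1.deriv]
    simp only [add_zero, sub_zero, TriData.mcr, TriData.σcr]
    ring

omit [T2Space X] [CompactSpace X] in
/-- **`∂₂₂Γ₂ = -w [2σ' + (q - a) σ_ε''(w_c)]`**, `σ_ε''(w_c) = creaseStep'(w_c/ε)/ε`. [folklore] -/
theorem fderiv_fderiv_Γ₂ (q : ℝ × ℝ) :
    fderiv ℝ (fderiv ℝ 𝔔.Γ₂) q (0, 1) (0, 1) =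
      -(𝔔.w q.1) * (2 * T.σcr q + (q.2 - B.a) * (deriv creaseStep (T.wcr q / T.ε) / T.ε)) := by
  have hc := 𝔔.contDiff_Γ₂
  have hε := T.ε_pos
  have hFd : DifferentiableAt ℝ (fderiv ℝ 𝔔.Γ₂) q :=
    ((hc.fderiv_right (m := 1) (by norm_cast)).differentiable (by simp)) q
  rw [fderiv_clm_apply_eq_deriv_line hFd]
  have hfun : (fun t : ℝ => fderiv ℝ 𝔔.Γ₂ (q + t • ((0 : ℝ), (1 : ℝ))) ((0 : ℝ), (1 : ℝ))) =
      fun t => 𝔔.w q.1 * ((-(q.1 - B.b) - creaseσ T.ε (T.wcr q + t)) -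
        ((q.2 - B.a) + t) * creaseStep ((T.wcr q + t) / T.ε)) := by
    funext t
    rw [(𝔔.Γ₂_partials _).1]
    simp only [TriData.mcr, TriData.σcr, TriData.wcr, Prod.smul_mk, smul_eq_mul, mul_zero, mul_one, Prod.fst_add,
      Prod.snd_add, add_zero]
    ring_nf
  rw [hfun]
  have hσ : HasDerivAt (fun t : ℝ => creaseσ T.ε (T.wcr q + t)) (creaseStep ((T.wcr q + 0) / T.ε)) 0 :=
    HasDerivAt.comp_const_add (T.wcr q) 0 (hasDerivAt_creaseσ hε _)
  have hin : HasDerivAt (fun t : ℝ => (T.wcr q + t) / T.ε) (1 / T.ε) 0 := by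
    have := ((hasDerivAt_id (0 : ℝ)).const_add (T.wcr q)).div_const T.ε
    simpa using this
  have hstep : HasDerivAt (fun t : ℝ => creaseStep ((T.wcr q + t) / T.ε))
      (deriv creaseStep ((T.wcr q + 0) / T.ε) * (1 / T.ε)) 0 :=
    ((contDiff_creaseStep.differentiable (by simp)) _).hasDerivAt.comp 0 hin
  have ht : HasDerivAt (fun t : ℝ => (q.2 - B.a) + t) 1 0 := by simpa using (hasDerivAt_id (0 : ℝ)).const_add (q.2 - B.a)
  have hm : HasDerivAt (fun t : ℝ => -(q.1 - B.b) - creaseσ T.ε (T.wcr q + t)) (0 - creaseStep ((T.wcr q + 0) / T.ε)) 0 :=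
    (hasDerivAt_const _ _).sub hσ
  have h1 : HasDerivAt (fun t : ℝ => 𝔔.w q.1 * ((-(q.1 - B.b) - creaseσ T.ε (T.wcr q + t)) -
      ((q.2 - B.a) + t) * creaseStep ((T.wcr q + t) / T.ε)))
      (𝔔.w q.1 * ((0 - creaseStep ((T.wcr q + 0) / T.ε)) -
        (1 * creaseStep ((T.wcr q + 0) / T.ε) + ((q.2 - B.a) + 0) * (deriv creaseStep ((T.wcr q + 0) / T.ε) * (1 / T.ε))))) 0 :=
    (hm.sub (ht.mul hstep)).const_mul _
  rw [h1.deriv]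
  simp only [add_zero, TriData.σcr]
  field_simp
  ring

omit [T2Space X] [CompactSpace X] in
/-- The partials of `Γ̂₂ = 1 - C Γ₂`. [folklore] -/
theorem fderiv_Γh (q : ℝ × ℝ) : fderiv ℝ 𝔔.Γh q = -(𝔔.C • fderiv ℝ 𝔔.Γ₂ q) := by
  have hd : DifferentiableAt ℝ 𝔔.Γ₂ q := (𝔔.contDiff_Γ₂.differentiable (by simp)) q
  unfold Γh
  rw [fderiv_const_sub, fderiv_const_mul hd]

omit [T2Space X] [CompactSpace X] in
/-- The second derivative of `Γ̂₂ = 1 - C Γ₂`. [folklore] -/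
theorem fderiv_fderiv_Γh (q : ℝ × ℝ) (v u : ℝ × ℝ) :
    fderiv ℝ (fderiv ℝ 𝔔.Γh) q v u = -𝔔.C * fderiv ℝ (fderiv ℝ 𝔔.Γ₂) q v u := by
  have hfd : fderiv ℝ 𝔔.Γh = fun q => -(𝔔.C • fderiv ℝ 𝔔.Γ₂ q) := funext 𝔔.fderiv_Γh
  have hFd : DifferentiableAt ℝ (fderiv ℝ 𝔔.Γ₂) q :=
    ((𝔔.contDiff_Γ₂.fderiv_right (m := 1) (by norm_cast)).differentiable (by simp)) q
  have hD' : HasFDerivAt (fun q => -(𝔔.C • fderiv ℝ 𝔔.Γ₂ q)) (-(𝔔.C • fderiv ℝ (fderiv ℝ 𝔔.Γ₂) q)) q :=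
    (hFd.hasFDerivAt.const_smul 𝔔.C).neg
  rw [hfd, hD'.fderiv]
  simp only [neg_apply, smul_apply, smul_eq_mul]
  ring

/-! ### Signs of the partials -/

omit [T2Space X] [CompactSpace X] in
/-- `0 ≤ σ' ≤ 1`. [folklore] -/
theorem _root_.Literature.Topology.FourManifolds.BiCollar.TriData.σcr_mem (T : B.TriData) (q : ℝ × ℝ) :
    T.σcr q ∈ Icc (0 : ℝ) 1 := ⟨creaseStep_nonneg _, creaseStep_le_one _⟩

/-- `σ_ε''(w) ≥ 0` (the crease step is monotone). [folklore] -/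
theorem _root_.Literature.Topology.FourManifolds.deriv_creaseStep_nonneg (x : ℝ) : 0 ≤ deriv creaseStep x :=
  monotone_creaseStep.deriv_nonneg

omit [T2Space X] [CompactSpace X] in
/-- **Where `∂₂Γ₂ = 0` with `q > a` and `m > 0`: `σ' > 0` and `∂₂₂Γ₂ < 0`.** [folklore] -/
theorem fderiv_fderiv_Γ₂_neg {q : ℝ × ℝ} (hq : B.a < q.2) (hm : 0 < T.mcr q)
    (h2 : fderiv ℝ 𝔔.Γ₂ q (0, 1) = 0) :
    0 < T.σcr q ∧ fderiv ℝ (fderiv ℝ 𝔔.Γ₂) q (0, 1) (0, 1) < 0 := by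
  rw [(𝔔.Γ₂_partials q).1] at h2
  have hw := 𝔔.w_pos q.1
  have hbr : T.mcr q - (q.2 - B.a) * T.σcr q = 0 := by
    rcases mul_eq_zero.1 h2 with h | h
    · exact absurd h hw.ne'
    · exact h
  have hσpos : 0 < T.σcr q := by
    by_contra h
    push Not at h
    have h0 : T.σcr q = 0 := le_antisymm h (creaseStep_nonneg _)
    rw [h0, mul_zero, sub_zero] at hbr
    linarith
  refine ⟨hσpos, ?_⟩
  rw [𝔔.fderiv_fderiv_Γ₂ q]
  have h1 : 0 ≤ (q.2 - B.a) * (deriv creaseStep (T.wcr q / T.ε) / T.ε) :=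
    mul_nonneg (by linarith) (div_nonneg (deriv_creaseStep_nonneg _) T.ε_pos.le)
  nlinarith

omit [T2Space X] [CompactSpace X] in
/-- **Where `∂₂Γ₂ = 0` with `q > a`, `m > 0`: `∂₁Γ₂ < 0`** — either `σ' < 1`, or the rounding is
on its plateau (`w_c ≥ ε`), `m = c - q` and `q` is the mid-height `(a + c)/2`, so that
`p - b ≤ -(c - a)/2 - ε < -δ_w` and `w'(p) < 0`. [cite: GayKirby2016, §4, Lemma 14] -/
theorem fderiv_Γ₂_fst_neg {q : ℝ × ℝ} (hq : B.a < q.2) (hm : 0 < T.mcr q)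
    (h2 : fderiv ℝ 𝔔.Γ₂ q (0, 1) = 0) : fderiv ℝ 𝔔.Γ₂ q (1, 0) < 0 := by
  obtain ⟨h2a, h1⟩ := 𝔔.Γ₂_partials q
  rw [h1]
  rw [h2a] at h2
  have hw := 𝔔.w_pos q.1
  have hw' := 𝔔.w_deriv_nonpos q.1
  have hbr : T.mcr q - (q.2 - B.a) * T.σcr q = 0 := by
    rcases mul_eq_zero.1 h2 with h | h
    · exact absurd h hw.ne'
    · exact h
  obtain ⟨hσ0, hσ1⟩ := T.σcr_mem q
  have hqa : 0 < q.2 - B.a := by linarith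
  have hterm2 : T.mcr q * deriv 𝔔.w q.1 ≤ 0 := mul_nonpos_of_nonneg_of_nonpos hm.le hw'
  rcases hσ1.lt_or_eq with hlt | heq
  · have hterm1 : (T.σcr q - 1) * 𝔔.w q.1 < 0 := mul_neg_of_neg_of_pos (by linarith) hw
    exact mul_neg_of_pos_of_neg hqa (by linarith)
  · -- plateau: `σ' = 1` forces `w_c ≥ ε`... precisely `w_c/ε ≥ 1`? only `> -1`; use `σ(w_c) ≥ w_c`
    have hterm1 : (T.σcr q - 1) * 𝔔.w q.1 = 0 := by rw [heq]; ring
    -- from `σ' = 1`: `creaseStep (w_c/ε) = 1` gives `w_c / ε ≥ 1`?  `creaseStep_lt_one` for `x < 1`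
    have hwc : T.ε ≤ T.wcr q := by
      by_contra hlt
      push Not at hlt
      have : T.wcr q / T.ε < 1 := by rw [div_lt_one T.ε_pos]; exact hlt
      have := creaseStep_lt_one this
      exact absurd heq (ne_of_lt this)
    have hσeq : creaseσ T.ε (T.wcr q) = T.wcr q := creaseσ_of_le T.ε_pos hwc
    -- `m = -(p - b) - w_c = c - q`, and `m = (q - a) σ' = q - a`
    have hm' : T.mcr q = T.c - q.2 := by
      show -(q.1 - B.b) - creaseσ T.ε (T.wcr q) = _
      rw [hσeq]; simp only [TriData.wcr]; ring
    rw [heq, mul_one] at hbr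
    have hqmid : q.2 = (B.a + T.c) / 2 := by linarith
    have hp : q.1 < B.b - 𝔔.δw := by
      have hwcdef : T.wcr q = q.2 - T.c - (q.1 - B.b) := rfl
      have := 𝔔.δw_lt
      linarith
    have hw'neg : deriv 𝔔.w q.1 < 0 := 𝔔.w_deriv_neg _ hp
    have hterm2' : T.mcr q * deriv 𝔔.w q.1 < 0 := mul_neg_of_pos_of_neg hm hw'neg
    exact mul_neg_of_pos_of_neg hqa (by linarith)

/-! ### The flow-rule region and the reading `Ψ₂ = Γ₂(φ̄, f)` -/

/-- At a hitting point, `λ̂ p = (levelProj p, _)`. [folklore] -/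
theorem _root_.Literature.Topology.FourManifolds.BiCollar.lamLift_eq_mk_levelProj (B : BiCollar X) {p : X}
    (hh : B.Hit p) : B.lamLift p = ⟨levelProj B.U.contMDiff B.f B.a p, apply_levelProj B.U.contMDiff hh⟩ :=
  Subtype.ext (B.incl_lamLift hh)

/-- At a hitting point, `φ̄ = G + b` for the lift of `g` along the unit field. [folklore] -/
theorem _root_.Literature.Topology.FourManifolds.BiCollar.flowLift_eq_gFun_add_b (B : BiCollar X) {p : X}
    (hh : B.Hit p) : flowLift B.U.contMDiff B.hf B.g p = B.gFun p + B.b := by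
  rw [gFun, flowLift_of_hits B.g hh, B.lamLift_eq_mk_levelProj hh]; ring

omit [Fintype ι] in
/-- At a hitting point, `m(φ̄, f) = -M`. [folklore] -/
theorem _root_.Literature.Topology.FourManifolds.BiCollar.TriData.mcr_eq_neg_M (T : B.TriData) {p : X} (hh : B.Hit p) :
    T.mcr (flowLift B.U.contMDiff B.hf B.g p, B.f p) = -T.M p := by
  simp only [TriData.mcr, TriData.wcr, B.flowLift_eq_gFun_add_b hh, TriData.M, TriData.w]
  ring


/-- **The flow-rule region**: hitting points above the bevel (`s > rOut₁`) which lie at distance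
`A_j > a_R` from the co-cores on the chart domains. [cite: GayKirby2016, §4, Lemma 14] -/
def FR : Set X := {p | B.Hit p ∧ T.D.χ₁.rOut < B.sFun p ∧ ∀ j, p ∈ (𝔉.boxes.box j).chart.source → 𝔔.aR < 𝔉.boxes.A j p}

/-- Membership in the flow-rule region. [folklore] -/
theorem mem_FR {p : X} : p ∈ 𝔔.FR ↔
    B.Hit p ∧ T.D.χ₁.rOut < B.sFun p ∧ ∀ j, p ∈ (𝔉.boxes.box j).chart.source → 𝔔.aR < 𝔉.boxes.A j p := Iff.rfl

/-- **Near a point of the flow-rule region at `X₂`-height, no chart zone and `R = 1`.** [folklore] -/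
theorem eventually_not_mem_zone_of_mem_FR {p : X} (hp : p ∈ 𝔔.FR) (hf₂ : B.f p < B.a + 2 * 𝔉.η₂) :
    ∀ᶠ y in 𝓝 p, ∀ j, y ∉ 𝔉.boxes.zone 𝔔.aR j := by
  refine Filter.eventually_all.2 fun j => ?_
  by_cases hj : p ∈ (𝔉.boxes.box j).chart.source
  · have hA := hp.2.2 j hj
    have hcA : ContinuousAt (𝔉.boxes.A j) p :=
      (𝔉.boxes.continuousOn_A j).continuousAt ((𝔉.boxes.box j).chart.open_source.mem_nhds hj)
    filter_upwards [hcA.eventually (Ioi_mem_nhds hA)] with y hy hyz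
    exact absurd hyz.2 (not_lt.2 (le_of_lt hy))
  · exact 𝔉.boxes.eventually_not_mem_zone_of_not_mem_source 𝔔.aR_le B.U.contMDiff_f.continuous hj hf₂

/-- **`Ψ₂ = Γ₂(φ̄, f)` near a point of the flow-rule region at `X₂`-height** (`φ̄` the lift of `g`
along the unit field). [cite: GayKirby2016, §4, Lemma 14] -/
theorem PsiTwo_eventuallyEq_Γ₂ {p : X} (hp : p ∈ 𝔔.FR) (hf₂ : B.f p < B.a + 2 * 𝔉.η₂) :
    𝔔.PsiTwo =ᶠ[𝓝 p] fun x => 𝔔.Γ₂ (flowLift B.U.contMDiff B.hf B.g x, B.f x) := by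
  have hh := hp.1
  have hs := hp.2.1
  filter_upwards [𝔔.eventually_not_mem_zone_of_mem_FR hp hf₂, T.Fr.isOpen_setOf_hit.mem_nhds hh,
    (isOpen_lt continuous_const B.contMDiff_sFun.continuous).mem_nhds hs] with x hz hxh hxs
  have hxh' : B.Hit x := hxh
  have hG : B.gFun x = flowLift B.U.contMDiff B.hf B.g x - B.b := by
    rw [B.flowLift_eq_gFun_add_b hxh']; ring
  have hV : -T.D.faceV x = B.sFun x := by
    rw [T.D.faceV_eq_neg_sFun_of_le (by rw [abs_of_pos (T.D.χ₁.rOut_pos.trans hxs)]; exact le_of_lt hxs), neg_neg]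
  have hW : 𝔔.W x = 𝔔.w (flowLift B.U.contMDiff B.hf B.g x) := by
    unfold W
    rw [𝔉.boxes.weight_of_forall_not_mem hz, 𝔉.flowLift_eq_gFun_add hxh', hG, sub_add_cancel]
  have hR : 𝔔.Rad x = 1 := by
    unfold Rad
    refine 𝔉.boxes.radial_eq_one_of_le 𝔔.R₀_eq_one fun j hj => ?_
    by_contra hlt
    push Not at hlt
    exact hz j ⟨hj, hlt.trans 𝔔.aR'_lt⟩
  rw [PsiTwo, hV, T.Mt_of_hit hxh', hW, hR, mul_one, Γ₂_apply, TriData.M, TriData.w, hG]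
  simp only [BiCollar.sFun]
  ring

/-- **`ψ₂ = Γ̂₂(φ̄, f)` near a point of the flow-rule region.** [cite: GayKirby2016, §4, Lemma 14] -/
theorem psiTwo_eventuallyEq_Γh {p : X} (hp : p ∈ 𝔔.FR) (hf₂ : B.f p < B.a + 2 * 𝔉.η₂) :
    𝔔.psiTwo =ᶠ[𝓝 p] fun x => 𝔔.Γh (flowLift B.U.contMDiff B.hf B.g x, B.f x) := by
  filter_upwards [𝔔.PsiTwo_eventuallyEq_Γ₂ hp hf₂] with x hx
  rw [psiTwo, hx, Γh]

/-! ### Criticality and Morse data in the flow-rule region -/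

/-- **`ψ₂` is critical at an interior point of `X₂` in the flow-rule region iff `∂₂Γ₂(φ̄, f) = 0`
and the landing point is a critical point of `g`.** [cite: GayKirby2016, §4, Lemma 14] [cite: Milnor1963, §3] -/
theorem isMCriticalPt_psiTwo_iff_of_mem_FR {p : X} (hp : p ∈ 𝔔.FR) (hx2 : p ∈ T.X₂) (hM : T.Mt p ≠ 0) :
    IsMCriticalPt (𝓡 4) 𝔔.psiTwo p ↔
      fderiv ℝ 𝔔.Γ₂ (flowLift B.U.contMDiff B.hf B.g p, B.f p) (0, 1) = 0 ∧
        IsMCriticalPt (𝓡 3) B.g (B.lamLift p) := by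
  have hh := hp.1
  have hf₂ := (𝔉.f_bounds_of_mem_X₂ hx2).2
  have hev := 𝔔.psiTwo_eventuallyEq_Γh hp hf₂
  have hΓ : ContDiffAt ℝ 1 𝔔.Γh (flowLift B.U.contMDiff B.hf B.g p, B.f p) :=
    (𝔔.contDiff_Γh.of_le (by norm_cast)).contDiffAt
  rw [isMCriticalPt_congr_of_eventuallyEq hev,
    isMCriticalPt_comp₂_iff T.Fr.isGradientLike T.Fr.isMorse B.V.contMDiff_f hh hΓ, ← B.lamLift_eq_mk_levelProj hh,
    𝔔.fderiv_Γh]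
  simp only [neg_apply, smul_apply, smul_eq_mul, mul_eq_zero, neg_eq_zero, 𝔔.C_pos.ne', false_or]
  -- `∂₁Γ₂ ≠ 0` where `∂₂Γ₂ = 0`
  have hqa : B.a < B.f p := by
    have := hp.2.1; have := T.D.χ₁.rOut_pos
    show B.a < B.f p; have : B.sFun p = B.f p - B.a := rfl; linarith
  have hm : 0 < T.mcr (flowLift B.U.contMDiff B.hf B.g p, B.f p) := by
    rw [T.mcr_eq_neg_M hh, ← T.Mt_of_hit hh]; exact T.neg_Mt_pos_of_mem_X₂ hx2 hM
  constructor
  · rintro ⟨h2, h1 | h1⟩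
    · exact absurd h1 (𝔔.fderiv_Γ₂_fst_neg hqa hm h2).ne
    · exact ⟨h2, h1⟩
  · rintro ⟨h2, h1⟩
    exact ⟨h2, Or.inr h1⟩

/-- **The critical points of `ψ₂` in the flow-rule region are nondegenerate, of index the Morse
index of `g` at the landing point** (`g` Morse). [cite: GayKirby2016, §4, Lemma 14] [cite: Milnor1963, §2–§3] -/
theorem morseData_psiTwo_of_mem_FR (hgM : IsMorse (𝓡 3) B.g) {p : X} (hp : p ∈ 𝔔.FR) (hx2 : p ∈ T.X₂)
    (hM : T.Mt p ≠ 0) (hc : IsMCriticalPt (𝓡 4) 𝔔.psiTwo p) :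
    (mhessian (𝓡 4) 𝔔.psiTwo p).Nondegenerate ∧
      morseIndex (𝓡 4) 𝔔.psiTwo p = morseIndex (𝓡 3) B.g (B.lamLift p) := by
  have hh := hp.1
  have hf₂ := (𝔉.f_bounds_of_mem_X₂ hx2).2
  obtain ⟨h2, hcg⟩ := (𝔔.isMCriticalPt_psiTwo_iff_of_mem_FR hp hx2 hM).1 hc
  have hqa : B.a < B.f p := by
    have := hp.2.1; have := T.D.χ₁.rOut_pos
    show B.a < B.f p; have : B.sFun p = B.f p - B.a := rfl; linarith
  have hm : 0 < T.mcr (flowLift B.U.contMDiff B.hf B.g p, B.f p) := by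
    rw [T.mcr_eq_neg_M hh, ← T.Mt_of_hit hh]; exact T.neg_Mt_pos_of_mem_X₂ hx2 hM
  have h1 := 𝔔.fderiv_Γ₂_fst_neg hqa hm h2
  obtain ⟨-, h22⟩ := 𝔔.fderiv_fderiv_Γ₂_neg hqa hm h2
  -- the level point and the flow time
  set y₀ : B.Y := B.lamLift p with hy₀
  have hy₀v : y₀.1 = levelProj B.U.contMDiff B.f B.a p := congrArg Subtype.val (B.lamLift_eq_mk_levelProj hh)
  obtain ⟨t₀, ht₀⟩ : ∃ t, flow B.U.contMDiff y₀.1 t = p := by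
    rw [hy₀v]; exact mem_range_flow_levelProj B.U.contMDiff B.a p
  have hgl := T.Fr.isGradientLike
  have hfM := T.Fr.isMorse
  have hφy : flowLift B.U.contMDiff B.hf B.g p = B.g y₀ := by
    rw [← ht₀, flowLift_flow hgl hfM B.g (hits_of_level y₀) t₀, flowLift_apply hgl hfM B.g y₀]
  -- move to `Γ̂₂(φ̄, f)` and to the point `flow y₀ t₀`
  have hev := 𝔔.psiTwo_eventuallyEq_Γh hp hf₂
  have hev0 : 𝔔.psiTwo =ᶠ[𝓝 p] fun x => (fun x => 𝔔.Γh (flowLift B.U.contMDiff B.hf B.g x, B.f x)) x + 0 :=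
    hev.trans (Eventually.of_forall fun x => (add_zero _).symm)
  rw [mhessian_congr_of_eventuallyEq_add_const hev0, morseIndex_congr_of_eventuallyEq hev]
  rw [← ht₀]
  have hpt : (B.g y₀, B.f (flow B.U.contMDiff y₀.1 t₀)) = (flowLift B.U.contMDiff B.hf B.g p, B.f p) := by
    rw [ht₀, hφy]
  have hΓ : ContDiffAt ℝ 2 𝔔.Γh (B.g y₀, B.f (flow B.U.contMDiff y₀.1 t₀)) :=
    (𝔔.contDiff_Γh.of_le (by norm_cast)).contDiffAt
  have h2' : fderiv ℝ 𝔔.Γh (B.g y₀, B.f (flow B.U.contMDiff y₀.1 t₀)) (0, 1) = 0 := by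
    rw [hpt, 𝔔.fderiv_Γh]; simp [h2]
  have h1' : 0 < fderiv ℝ 𝔔.Γh (B.g y₀, B.f (flow B.U.contMDiff y₀.1 t₀)) (1, 0) := by
    rw [hpt, 𝔔.fderiv_Γh]
    simp only [neg_apply, smul_apply, smul_eq_mul]
    nlinarith [𝔔.C_pos]
  have h22' : 0 < fderiv ℝ (fderiv ℝ 𝔔.Γh) (B.g y₀, B.f (flow B.U.contMDiff y₀.1 t₀)) (0, 1) (0, 1) := by
    rw [hpt, 𝔔.fderiv_fderiv_Γh]; nlinarith [𝔔.C_pos]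
  refine ⟨(nondegenerate_mhessian_comp₂_flow_iff (hξ := B.U.contMDiff) (h := B.hf) hgl hfM hgM y₀ t₀ hcg hΓ h2'
      h1'.ne').2 h22'.ne', ?_⟩
  rw [morseIndex_comp₂_flow_eq (hξ := B.U.contMDiff) (h := B.hf) hgl hfM hgM y₀ t₀ hcg hΓ h2' h1'.ne' h22'.ne',
    if_neg (not_lt.2 h22'.le), if_pos h1', zero_add]

end MidParams

end TubeFrame

end TriData

end BiCollar

end Literature.Topology.FourManifolds

end
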